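/-
Copyright (c) 2026 the pub-hodgecm-mathlib formalisation cell (harness21).  Prover seat hodgecm-mathlib-LH4-p04 (g2), req620 Track A «(D-RAM) FOUR-FRAME» squad
(unit U3_Laws, (KMS) road «MODULO κ-STAGE B», brick κB-T «T-STRATA κ-SOCKETS», FILE 2∕3: THE κ-COUNT OF THE SPLIT LATTICES AND OF THE ROOT; dealer LH4-plan (g11) WORD #35 (2);
head letters F0P3a-p01 (g32) 2026-09-04T01:25:48Z (B); plan LH4-p05 (g3) `PLAN-KMS-modKappaStageB.v1` §4 row «on-branch»).  2026-09-04.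
-/
import Summits.HodgeConjecture.HodgeConjecture.Theorems.F0P3cDyRamDiagonalKappaSplitCountEval   -- FILE 1 (this seat): ω∕χ bookkeeping, explicit polarisations, ALIVE engine; brings Fκ2∕Fκ1 (LH4-p05), ★ B4 split lattices (LH4-p13), ★ LocalFields (deep norms, NI2 exact, level non-norm)
import HarnessLib

/-!
# Crux `H413`, line LH4 «(D-RAM) FOUR-FRAME» road — unit U3_Laws (iii), (KMS) road «MODULO κ-STAGE B», brick κB-T FILE 2∕3: THE SIGNED κ-COUNT OF THE SPLIT (ON-BRANCH)
# LATTICES `kappaCount σ ϖ 0 i (M_k(s,·)) = ω(−1)·[i = foot]·[s ≥ 2d]`, and `= 0` on the root `𝒪³`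

Cell `hodgecm-mathlib` (D-0151), FLOOR 0, crux item H413 = `stmt-HodgeConjecture-24833`, route of record `HCCMUnconditional`; squad F0∕P3c∕LH4 (req618∕req620); registered stub served:
`F0P3cDyRamFourFrameU3.stub_U3_kappaModelSum` (KMS; tree `Cruxes/H413/Lines/F0_P3c_DyRamFourFrame_U3_Laws.lean` ED. 7 :407–:429).  THEOREMS ONLY (no `def`, no instance, no notation,
no `sorry`, default heartbeats); lane `--supports stmt-HodgeConjecture-24833 --as helper` (count-neutral).  This is the per-lattice input of FILE 3 `…DiagonalKappaSplitCountSockets`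
(the four T-strata κ-sockets of LH4-p05 (g3)'s κ-Stage-B table); the tools are FILE 1 `…DiagonalKappaSplitCountEval`.

THE MATHEMATICS (PLAN v1 §4, row «on-branch»; Serre V §3 Cor. 3).  `ω = normSign σ` is the norm-residue sign of `F = K^σ`, `χ_i(u) = Π_{j ≠ i} ω(u_j)`, and by Fκ2
`kappaCount_zero_eq_of_dichotomy` the type-0 κ-count of a normalised lattice `M` with polarisation `D₁` is `χ_i(D₁)·[χ_i ≡ 1 on S_F(M)]`.  For the axis-1 on-branch lattice
`M₁(s,z) = latt (1 0 0; 0 1 0; 0 z ϖ^s)` (`|z| = 1`, `s = 2j`; the plane `⟨e₁,e₂⟩` at distance `s`, `e₀` split off): `S_F(M₁) = {u ∈ 𝒰^σ : |u₂ − u₁| ≤ |ϖ^s|}` (★ B4), i.e.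
`u₂∕u₁ ∈ U_F^{(s∕2)}`, and an explicit polarisation is `D₁ = (1, −zσz·π₀^{−j}, π₀^{−j})`, `π₀ = ϖσϖ = N(ϖ)` (★ B4, inside an `∃` — re-exported here).  Hence:
(ALIVE) for `s ≥ 2d` every `u ∈ S_F` has `u₂ = u₁·N(y)` (★ deep norms: fixed one-units of `F`-level `≥ d` are norms), so `χ_0(u) = ω(u₁)ω(u₂) = ω(u₁)² = 1`, and
`κ_0(M₁) = χ_0(D₁) = ω(−N z·π₀^{−j})·ω(π₀^{−j}) = ω(−1)` (norm factors drop, ★ `normSign_mul_norm`); (DEAD FOOT) for `s < 2d` the fixed non-norm unit `u₀ ∈ U_F^{(s∕2)}` of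
★ `exists_fixed_unit_not_norm_of_level_pow` gives `(1, 1, u₀) ∈ S_F` with `χ_0 = ω(u₀) = −1`, so `κ_0 = 0`; (DEAD OFF-FOOT) `(c, 1, 1) ∈ S_F` for the non-norm fixed unit `c` (★ NI2 exact)
has `χ_1 = χ_2 = ω(c) = −1`, so `κ_1 = κ_2 = 0`.  Axes 2 and 3 are the same computation with the slots permuted; on the root `𝒪³` (`S_F = 𝒰^σ`) every `χ_i` sees `c`, so `κ_i = 0`.

WHAT IS PROVED (`[CompleteSpace K] [Finite 𝓀[K]]`; completeness only through ★ `isAdicComplete_valuedInteger_of_completeSpace`).  `kappaCount_zero_latt_axis1∕2∕3` (`= if i = foot ∧ 2·d ≤ s then ω(−1) else 0`; foot index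
`0∕1∕2` for the planes `⟨e₁,e₂⟩∕⟨e₀,e₂⟩∕⟨e₀,e₁⟩`) and `kappaCount_zero_stdLattice` (`= 0`).
HONEST LABEL.  Count-neutral (`--supports`); nothing printed is asserted; (KMS) stays a PROVER TARGET (empirical census law in diagonal-model currency); `HC_CM` is proved only modulo
the 7 printed citations (2 remaining named inputs: hLiu418 = `stmt-HodgeConjecture-24832`, h413 = `stmt-HodgeConjecture-24833`) until rung 0 closes.

## References
* [Kottwitz1986BaseChangeUnits] R. E. Kottwitz, *Base change for unit elements of Hecke algebras*, Compositio Math. 60 (1986), §1 pp. 240–241 (κ-orbital integrals of units as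
  signed lattice counts modulo the torus).
* [Rogawski1990] J. D. Rogawski, *Automorphic Representations of Unitary Groups in Three Variables*, Ann. of Math. Stud. 123 (1990), §4.9 Prop. 4.9.1 (a) p. 55, §4.10 p. 58.
* [Serre1979] J.-P. Serre, *Local Fields*, GTM 67 (1979), Ch. V §3 Prop. 5, Cor. 3 (norms on the unit filtration; the conductor of a ramified quadratic extension).
* [Jacobowitz1962] R. Jacobowitz, *Hermitian forms over local fields*, Amer. J. Math. 84 (1962), §4, §7 (Gram matrices, unimodular lattices).
-/

set_option autoImplicit false

noncomputable section

namespace Summit.HodgeConjecture.HodgeConjecture.Cruxes.H413.F0P3cDyRamDiagonalKappaSplitCountValues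

open Matrix
open Literature.NumberTheory.Automorphic Literature.NumberTheory.Automorphic.HermitianLattice
open Literature.NumberTheory.Automorphic.UnitaryLatticeTree Literature.NumberTheory.Automorphic.UnitaryThreeFourFrame
open Literature.NumberTheory.LocalFields Literature.NumberTheory.LocalFields.WildQuadraticDatum
open Summit.HodgeConjecture.HodgeConjecture.Cruxes.H413.F0P3cDyRamDiagonalTorusDefs
open Summit.HodgeConjecture.HodgeConjecture.Cruxes.H413.F0P3cDyRamDiagonalStrataDefs
open Summit.HodgeConjecture.HodgeConjecture.Cruxes.H413.F0P3cDyRamDiagonalKappaCountDefs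
open Summit.HodgeConjecture.HodgeConjecture.Cruxes.H413.F0P3cDyRamDiagonalKappaCountEval
open Summit.HodgeConjecture.HodgeConjecture.Cruxes.H413.F0P3cDyRamStableSumSignClasses (normSign_eq_one_or)
open Summit.HodgeConjecture.HodgeConjecture.Cruxes.H413.F0P3cDyRamFixedCountDiagonalModel (normSign_mul_norm)
open Summit.HodgeConjecture.HodgeConjecture.Cruxes.H413.F0P3cDyRamDiagonalStratumTools
open Summit.HodgeConjecture.HodgeConjecture.Cruxes.H413.F0P3cDyRamDiagonalGluedTubeCriterion (formCongr_hnf_diagonal)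
open Summit.HodgeConjecture.HodgeConjecture.Cruxes.H413.F0P3cDyRamDiagonalCoreUnique
open Summit.HodgeConjecture.HodgeConjecture.Cruxes.H413.F0P3cDyRamDiagonalSplitCount
open Summit.HodgeConjecture.HodgeConjecture.Cruxes.H413.F0P3cDyRamDiagonalSplitCountAxisOne
open Summit.HodgeConjecture.HodgeConjecture.Cruxes.H413.F0P3cDyRamDiagonalSplitCountAxisTwo
open Summit.HodgeConjecture.HodgeConjecture.Cruxes.H413.F0P3cDyRamDiagonalSplitCountSockets (mapGL_diagonal_stdLattice_eq)
open Summit.HodgeConjecture.HodgeConjecture.Cruxes.H413.F0P3cDyRamDiagonalKappaSplitCountEval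
open scoped Valued WithZero Matrix MatrixGroups

variable {K : Type} [Field K] [Valued K ℤᵐ⁰]

/-! ## §1  The κ-count of the three split lattices -/

/-- **AXIS 1 (plane `⟨e₁,e₂⟩`, foot index `0`)**: for `|z| = 1` and even `s`, `kappaCount σ ϖ 0 i (M₁(s,z)) = ω(−1)` if `i = 0 ∧ 2d ≤ s`, and `0` otherwise (ALIVE by deep norms,
DEAD FOOT by the level-`s∕2` non-norm, DEAD OFF-FOOT by `(c,1,1)`). [cite: Kottwitz1986BaseChangeUnits, §1 pp. 240–241] [cite: Serre1979, Ch. V §3 Prop. 5, Cor. 3]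
[cite: Rogawski1990, §4.10 p. 58] -/
theorem kappaCount_zero_latt_axis1 [CompleteSpace K] [Finite 𝓀[K]] {σ : K →+* K} {ϖ : K} {d t : ℕ} (hD : IsRamifiedQuadraticDatum σ ϖ d t)
    {z : K} (hz : Valued.v z = 1) {s : ℕ} (h2 : 2 ∣ s) (i : Fin 3) :
    kappaCount σ ϖ 0 i (latt (!![1, 0, 0; 0, 1, 0; 0, z, ϖ ^ s] : Matrix (Fin 3) (Fin 3) K)) = if i = 0 ∧ 2 * d ≤ s then normSign σ (-1 : K) else 0 := by
  have hD' := hD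
  obtain ⟨hσ, hvσ, hϖ, -, -, -, -⟩ := hD'
  haveI : IsAdicComplete 𝓂[K] 𝒪[K] := isAdicComplete_valuedInteger_of_completeSpace hϖ
  obtain ⟨c, hσc, hcv, hc, hdich⟩ := exists_nonnorm_dichotomy_of_isRamifiedQuadraticDatum σ ϖ d t hD
  obtain ⟨j, rfl⟩ := h2
  have hϖ0 : ϖ ≠ 0 := fun h0 => by rw [h0, map_zero] at hϖ; exact WithZero.coe_ne_zero hϖ.symm
  have hϖ1 : Valued.v ϖ ≤ 1 := by rw [hϖ, ← WithZero.exp_zero, WithZero.exp_le_exp]; norm_num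
  have hσϖ0 : σ ϖ ≠ 0 := (map_ne_zero σ).2 hϖ0
  have hz0 : z ≠ 0 := fun h => by rw [h, map_zero] at hz; exact zero_ne_one hz
  have hc0 : c ≠ 0 := fun h => by rw [h, map_zero] at hcv; exact zero_ne_one hcv
  have hπ₀σ : σ (ϖ * σ ϖ) = ϖ * σ ϖ := by rw [map_mul, hσ, mul_comm]
  have hd₁σ : σ (((ϖ * σ ϖ) ^ j)⁻¹) = ((ϖ * σ ϖ) ^ j)⁻¹ := by rw [map_inv₀, map_pow, hπ₀σ]
  have hd₁0 : (((ϖ * σ ϖ) ^ j)⁻¹ : K) ≠ 0 := inv_ne_zero (pow_ne_zero _ (mul_ne_zero hϖ0 hσϖ0))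
  have hD₁ : ∀ k : Fin 3, σ ((![1, -(σ z * ((ϖ * σ ϖ) ^ j)⁻¹ * z), ((ϖ * σ ϖ) ^ j)⁻¹] : Fin 3 → K) k) =
      (![1, -(σ z * ((ϖ * σ ϖ) ^ j)⁻¹ * z), ((ϖ * σ ϖ) ^ j)⁻¹] : Fin 3 → K) k ∧ (![1, -(σ z * ((ϖ * σ ϖ) ^ j)⁻¹ * z), ((ϖ * σ ϖ) ^ j)⁻¹] : Fin 3 → K) k ≠ 0 := by
    intro k
    fin_cases k
    · exact ⟨map_one σ, one_ne_zero⟩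
    · refine ⟨?_, ?_⟩
      · show σ (-(σ z * ((ϖ * σ ϖ) ^ j)⁻¹ * z)) = -(σ z * ((ϖ * σ ϖ) ^ j)⁻¹ * z)
        rw [map_neg, map_mul, map_mul, hσ, hd₁σ]; ring
      · show -(σ z * ((ϖ * σ ϖ) ^ j)⁻¹ * z) ≠ 0
        exact neg_ne_zero.2 (mul_ne_zero (mul_ne_zero ((map_ne_zero σ).2 hz0) hd₁0) hz0)
    · exact ⟨hd₁σ, hd₁0⟩
  rw [kappaCount_zero_eq_of_dichotomy hvσ hσc hc hdich ϖ i (Matrix.GeneralLinearGroup.mkOfDetNeZero _ (det_axis1_ne_zero hϖ0 z (2 * j)))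
    (M := latt (!![1, 0, 0; 0, 1, 0; 0, z, ϖ ^ (2 * j)] : Matrix (Fin 3) (Fin 3) K)) rfl
    (isNormalisedLattice_latt_axis1 hϖ1 hz (2 * j)) hD₁ (isVertexLattice_latt_axis1 hvσ hϖ hz j)]
  -- the fixed-unit stabiliser: `u ∈ S_F ↔ u ∈ 𝒰^σ ∧ |u₂ − u₁| ≤ |ϖ^s|`
  have hSF := fun u => mem_fixedUnitStabilizer_latt_axis1_iff σ hϖ0 hz (2 * j) u
  by_cases hi : i = 0
  · subst hi
    by_cases hds : 2 * d ≤ 2 * j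
    · -- ALIVE
      have hall : ∀ u ∈ fixedUnitStabilizer σ (latt (!![1, 0, 0; 0, 1, 0; 0, z, ϖ ^ (2 * j)] : Matrix (Fin 3) (Fin 3) K)),
          chiVec σ 0 (fun k => ((u k : Kˣ) : K)) = 1 := by
        intro u hu
        obtain ⟨huT, h21⟩ := (hSF u).1 hu
        obtain ⟨huv, huσ⟩ := (mem_fixedUnitTorus_iff σ u).1 huT
        have hle : Valued.v (((u 1 : Kˣ) : K) - (u 2 : Kˣ)) ≤ Valued.v ϖ ^ (2 * d) := by
          rw [Valuation.map_sub_swap]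
          exact h21.trans (by rw [map_pow]; exact (UnitaryLatticeTree.v_pow_le_v_pow_iff hϖ _ _).2 hds)
        rw [chiVec_zero]
        show normSign σ ((u 1 : Kˣ) : K) * normSign σ ((u 2 : Kˣ) : K) = 1
        rw [normSign_eq_of_near hD (huσ 1) (huσ 2) (huv 1) (n := 2 * d) (by omega) hle, normSign_mul_self]
      rw [if_pos hall, if_pos (show (0 : Fin 3) = 0 ∧ 2 * d ≤ 2 * j from ⟨rfl, hds⟩), chiVec_zero]
      show normSign σ (-(σ z * ((ϖ * σ ϖ) ^ j)⁻¹ * z)) * normSign σ (((ϖ * σ ϖ) ^ j)⁻¹) = normSign σ (-1)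
      rw [normSign_neg_polarisation_entry hϖ0 hz0 j, normSign_normVarpi_pow_inv hϖ0 j, mul_one]
    · -- DEAD FOOT: the level-`j` non-norm `u₀` gives `(1, 1, u₀) ∈ S_F` with `χ_0 = ω(u₀) = −1`
      obtain ⟨u₀, hσu₀, hu₀1, hu₀, hu₀n⟩ := exists_fixed_unit_not_norm_of_level_pow σ ϖ d t hD (n := j) (by omega)
      have hu₀0 : u₀ ≠ 0 := fun h => by rw [h, map_zero] at hu₀1; exact zero_ne_one hu₀1
      have hnall : ¬ ∀ u ∈ fixedUnitStabilizer σ (latt (!![1, 0, 0; 0, 1, 0; 0, z, ϖ ^ (2 * j)] : Matrix (Fin 3) (Fin 3) K)),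
          chiVec σ 0 (fun k => ((u k : Kˣ) : K)) = 1 := by
        intro hall
        have hmem : (![1, 1, Units.mk0 u₀ hu₀0] : Fin 3 → Kˣ) ∈
            fixedUnitStabilizer σ (latt (!![1, 0, 0; 0, 1, 0; 0, z, ϖ ^ (2 * j)] : Matrix (Fin 3) (Fin 3) K)) := by
          refine (hSF _).2 ⟨(mem_fixedUnitTorus_iff σ _).2 ⟨fun k => ?_, fun k => ?_⟩, ?_⟩
          · fin_cases k <;> simp [hu₀1]
          · fin_cases k <;> simp [hσu₀]
          · simpa using hu₀
        have h : normSign σ ((1 : Kˣ) : K) * normSign σ ((Units.mk0 u₀ hu₀0 : Kˣ) : K) = 1 := hall _ hmem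
        rw [Units.val_one, Units.val_mk0, normSign_one, normSign_of_not_isNorm σ hu₀n] at h
        norm_num at h
      rw [if_neg hnall, if_neg (fun h => hds h.2)]
  · -- DEAD OFF-FOOT: `(c, 1, 1) ∈ S_F` with `χ_1 = χ_2 = ω(c) = −1`
    have hnall : ¬ ∀ u ∈ fixedUnitStabilizer σ (latt (!![1, 0, 0; 0, 1, 0; 0, z, ϖ ^ (2 * j)] : Matrix (Fin 3) (Fin 3) K)),
        chiVec σ i (fun k => ((u k : Kˣ) : K)) = 1 := by
      intro hall
      have hmem : (![Units.mk0 c hc0, 1, 1] : Fin 3 → Kˣ) ∈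
          fixedUnitStabilizer σ (latt (!![1, 0, 0; 0, 1, 0; 0, z, ϖ ^ (2 * j)] : Matrix (Fin 3) (Fin 3) K)) := by
        refine (hSF _).2 ⟨(mem_fixedUnitTorus_iff σ _).2 ⟨fun k => ?_, fun k => ?_⟩, ?_⟩
        · fin_cases k <;> simp [hcv]
        · fin_cases k <;> simp [hσc]
        · simp
      have hωc := normSign_of_not_isNorm σ hc
      obtain rfl | rfl : i = 1 ∨ i = 2 := by
        fin_cases i
        · exact absurd rfl hi
        · exact Or.inl rfl
        · exact Or.inr rfl
      all_goals
        have h : normSign σ ((Units.mk0 c hc0 : Kˣ) : K) * normSign σ ((1 : Kˣ) : K) = 1 := hall _ hmem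
        rw [Units.val_one, Units.val_mk0, normSign_one, hωc] at h
        norm_num at h
    rw [if_neg hnall, if_neg (fun h => hi h.1)]

/-- **AXIS 2 (plane `⟨e₀,e₂⟩`, foot index `1`)**: for `|y| = 1` and even `s`, `kappaCount σ ϖ 0 i (M₂(s,y)) = ω(−1)` if `i = 1 ∧ 2d ≤ s`, and `0` otherwise (ALIVE by deep norms,
DEAD FOOT by the level-`s∕2` non-norm, DEAD OFF-FOOT by `(1,c,1)`). [cite: Kottwitz1986BaseChangeUnits, §1 pp. 240–241] [cite: Serre1979, Ch. V §3 Prop. 5, Cor. 3]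
[cite: Rogawski1990, §4.10 p. 58] -/
theorem kappaCount_zero_latt_axis2 [CompleteSpace K] [Finite 𝓀[K]] {σ : K →+* K} {ϖ : K} {d t : ℕ} (hD : IsRamifiedQuadraticDatum σ ϖ d t)
    {y : K} (hy : Valued.v y = 1) {s : ℕ} (h2 : 2 ∣ s) (i : Fin 3) :
    kappaCount σ ϖ 0 i (latt (!![1, 0, 0; 0, 1, 0; y, 0, ϖ ^ s] : Matrix (Fin 3) (Fin 3) K)) = if i = 1 ∧ 2 * d ≤ s then normSign σ (-1 : K) else 0 := by
  have hD' := hD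
  obtain ⟨hσ, hvσ, hϖ, -, -, -, -⟩ := hD'
  haveI : IsAdicComplete 𝓂[K] 𝒪[K] := isAdicComplete_valuedInteger_of_completeSpace hϖ
  obtain ⟨c, hσc, hcv, hc, hdich⟩ := exists_nonnorm_dichotomy_of_isRamifiedQuadraticDatum σ ϖ d t hD
  obtain ⟨j, rfl⟩ := h2
  have hϖ0 : ϖ ≠ 0 := fun h0 => by rw [h0, map_zero] at hϖ; exact WithZero.coe_ne_zero hϖ.symm
  have hϖ1 : Valued.v ϖ ≤ 1 := by rw [hϖ, ← WithZero.exp_zero, WithZero.exp_le_exp]; norm_num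
  have hσϖ0 : σ ϖ ≠ 0 := (map_ne_zero σ).2 hϖ0
  have hy0 : y ≠ 0 := fun h => by rw [h, map_zero] at hy; exact zero_ne_one hy
  have hc0 : c ≠ 0 := fun h => by rw [h, map_zero] at hcv; exact zero_ne_one hcv
  have hπ₀σ : σ (ϖ * σ ϖ) = ϖ * σ ϖ := by rw [map_mul, hσ, mul_comm]
  have hd₁σ : σ (((ϖ * σ ϖ) ^ j)⁻¹) = ((ϖ * σ ϖ) ^ j)⁻¹ := by rw [map_inv₀, map_pow, hπ₀σ]
  have hd₁0 : (((ϖ * σ ϖ) ^ j)⁻¹ : K) ≠ 0 := inv_ne_zero (pow_ne_zero _ (mul_ne_zero hϖ0 hσϖ0))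
  have hD₁ : ∀ k : Fin 3, σ ((![-(σ y * ((ϖ * σ ϖ) ^ j)⁻¹ * y), 1, ((ϖ * σ ϖ) ^ j)⁻¹] : Fin 3 → K) k) =
      (![-(σ y * ((ϖ * σ ϖ) ^ j)⁻¹ * y), 1, ((ϖ * σ ϖ) ^ j)⁻¹] : Fin 3 → K) k ∧ (![-(σ y * ((ϖ * σ ϖ) ^ j)⁻¹ * y), 1, ((ϖ * σ ϖ) ^ j)⁻¹] : Fin 3 → K) k ≠ 0 := by
    intro k
    fin_cases k
    · refine ⟨?_, ?_⟩
      · show σ (-(σ y * ((ϖ * σ ϖ) ^ j)⁻¹ * y)) = -(σ y * ((ϖ * σ ϖ) ^ j)⁻¹ * y)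
        rw [map_neg, map_mul, map_mul, hσ, hd₁σ]; ring
      · show -(σ y * ((ϖ * σ ϖ) ^ j)⁻¹ * y) ≠ 0
        exact neg_ne_zero.2 (mul_ne_zero (mul_ne_zero ((map_ne_zero σ).2 hy0) hd₁0) hy0)
    · exact ⟨map_one σ, one_ne_zero⟩
    · exact ⟨hd₁σ, hd₁0⟩
  rw [kappaCount_zero_eq_of_dichotomy hvσ hσc hc hdich ϖ i (Matrix.GeneralLinearGroup.mkOfDetNeZero _ (det_axis2_ne_zero hϖ0 y (2 * j)))
    (M := latt (!![1, 0, 0; 0, 1, 0; y, 0, ϖ ^ (2 * j)] : Matrix (Fin 3) (Fin 3) K)) rfl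
    (isNormalisedLattice_latt_axis2 hϖ1 hy (2 * j)) hD₁ (isVertexLattice_latt_axis2 hvσ hϖ hy j)]
  -- the fixed-unit stabiliser: `u ∈ S_F ↔ u ∈ 𝒰^σ ∧ |u₂ − u₀| ≤ |ϖ^s|`
  have hSF := fun u => mem_fixedUnitStabilizer_latt_axis2_iff σ hϖ0 hy (2 * j) u
  by_cases hi : i = 1
  · subst hi
    by_cases hds : 2 * d ≤ 2 * j
    · -- ALIVE
      have hall : ∀ u ∈ fixedUnitStabilizer σ (latt (!![1, 0, 0; 0, 1, 0; y, 0, ϖ ^ (2 * j)] : Matrix (Fin 3) (Fin 3) K)),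
          chiVec σ 1 (fun k => ((u k : Kˣ) : K)) = 1 := by
        intro u hu
        obtain ⟨huT, h20⟩ := (hSF u).1 hu
        obtain ⟨huv, huσ⟩ := (mem_fixedUnitTorus_iff σ u).1 huT
        have hle : Valued.v (((u 0 : Kˣ) : K) - (u 2 : Kˣ)) ≤ Valued.v ϖ ^ (2 * d) := by
          rw [Valuation.map_sub_swap]
          exact h20.trans (by rw [map_pow]; exact (UnitaryLatticeTree.v_pow_le_v_pow_iff hϖ _ _).2 hds)
        rw [chiVec_one]
        show normSign σ ((u 0 : Kˣ) : K) * normSign σ ((u 2 : Kˣ) : K) = 1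
        rw [normSign_eq_of_near hD (huσ 0) (huσ 2) (huv 0) (n := 2 * d) (by omega) hle, normSign_mul_self]
      rw [if_pos hall, if_pos (show (1 : Fin 3) = 1 ∧ 2 * d ≤ 2 * j from ⟨rfl, hds⟩), chiVec_one]
      show normSign σ (-(σ y * ((ϖ * σ ϖ) ^ j)⁻¹ * y)) * normSign σ (((ϖ * σ ϖ) ^ j)⁻¹) = normSign σ (-1)
      rw [normSign_neg_polarisation_entry hϖ0 hy0 j, normSign_normVarpi_pow_inv hϖ0 j, mul_one]
    · -- DEAD FOOT: the level-`j` non-norm `u₀` gives `(1, 1, u₀) ∈ S_F` with `χ_1 = ω(u₀) = −1`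
      obtain ⟨u₀, hσu₀, hu₀1, hu₀, hu₀n⟩ := exists_fixed_unit_not_norm_of_level_pow σ ϖ d t hD (n := j) (by omega)
      have hu₀0 : u₀ ≠ 0 := fun h => by rw [h, map_zero] at hu₀1; exact zero_ne_one hu₀1
      have hnall : ¬ ∀ u ∈ fixedUnitStabilizer σ (latt (!![1, 0, 0; 0, 1, 0; y, 0, ϖ ^ (2 * j)] : Matrix (Fin 3) (Fin 3) K)),
          chiVec σ 1 (fun k => ((u k : Kˣ) : K)) = 1 := by
        intro hall
        have hmem : (![1, 1, Units.mk0 u₀ hu₀0] : Fin 3 → Kˣ) ∈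
            fixedUnitStabilizer σ (latt (!![1, 0, 0; 0, 1, 0; y, 0, ϖ ^ (2 * j)] : Matrix (Fin 3) (Fin 3) K)) := by
          refine (hSF _).2 ⟨(mem_fixedUnitTorus_iff σ _).2 ⟨fun k => ?_, fun k => ?_⟩, ?_⟩
          · fin_cases k <;> simp [hu₀1]
          · fin_cases k <;> simp [hσu₀]
          · simpa using hu₀
        have h : normSign σ ((1 : Kˣ) : K) * normSign σ ((Units.mk0 u₀ hu₀0 : Kˣ) : K) = 1 := hall _ hmem
        rw [Units.val_one, Units.val_mk0, normSign_one, normSign_of_not_isNorm σ hu₀n] at h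
        norm_num at h
      rw [if_neg hnall, if_neg (fun h => hds h.2)]
  · -- DEAD OFF-FOOT: `(1, c, 1) ∈ S_F` with `χ_0 = χ_2 = ω(c) = −1`
    have hnall : ¬ ∀ u ∈ fixedUnitStabilizer σ (latt (!![1, 0, 0; 0, 1, 0; y, 0, ϖ ^ (2 * j)] : Matrix (Fin 3) (Fin 3) K)),
        chiVec σ i (fun k => ((u k : Kˣ) : K)) = 1 := by
      intro hall
      have hmem : (![1, Units.mk0 c hc0, 1] : Fin 3 → Kˣ) ∈
          fixedUnitStabilizer σ (latt (!![1, 0, 0; 0, 1, 0; y, 0, ϖ ^ (2 * j)] : Matrix (Fin 3) (Fin 3) K)) := by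
        refine (hSF _).2 ⟨(mem_fixedUnitTorus_iff σ _).2 ⟨fun k => ?_, fun k => ?_⟩, ?_⟩
        · fin_cases k <;> simp [hcv]
        · fin_cases k <;> simp [hσc]
        · simp
      have hωc := normSign_of_not_isNorm σ hc
      obtain rfl | rfl : i = 0 ∨ i = 2 := by
        fin_cases i
        · exact Or.inl rfl
        · exact absurd rfl hi
        · exact Or.inr rfl
      · have h : normSign σ ((Units.mk0 c hc0 : Kˣ) : K) * normSign σ ((1 : Kˣ) : K) = 1 := hall _ hmem
        rw [Units.val_one, Units.val_mk0, normSign_one, hωc] at h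
        norm_num at h
      · have h : normSign σ ((1 : Kˣ) : K) * normSign σ ((Units.mk0 c hc0 : Kˣ) : K) = 1 := hall _ hmem
        rw [Units.val_one, Units.val_mk0, normSign_one, hωc] at h
        norm_num at h
    rw [if_neg hnall, if_neg (fun h => hi h.1)]

/-- **AXIS 3 (plane `⟨e₀,e₁⟩`, foot index `2`)**: for `|x| = 1` and even `s`, `kappaCount σ ϖ 0 i (M₃(s,x)) = ω(−1)` if `i = 2 ∧ 2d ≤ s`, and `0` otherwise (ALIVE by deep norms,
DEAD FOOT by the level-`s∕2` non-norm, DEAD OFF-FOOT by `(1,1,c)`). [cite: Kottwitz1986BaseChangeUnits, §1 pp. 240–241] [cite: Serre1979, Ch. V §3 Prop. 5, Cor. 3]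
[cite: Rogawski1990, §4.10 p. 58] -/
theorem kappaCount_zero_latt_axis3 [CompleteSpace K] [Finite 𝓀[K]] {σ : K →+* K} {ϖ : K} {d t : ℕ} (hD : IsRamifiedQuadraticDatum σ ϖ d t)
    {x : K} (hx : Valued.v x = 1) {s : ℕ} (h2 : 2 ∣ s) (i : Fin 3) :
    kappaCount σ ϖ 0 i (latt (!![1, 0, 0; x, ϖ ^ s, 0; 0, 0, 1] : Matrix (Fin 3) (Fin 3) K)) = if i = 2 ∧ 2 * d ≤ s then normSign σ (-1 : K) else 0 := by
  have hD' := hD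
  obtain ⟨hσ, hvσ, hϖ, -, -, -, -⟩ := hD'
  haveI : IsAdicComplete 𝓂[K] 𝒪[K] := isAdicComplete_valuedInteger_of_completeSpace hϖ
  obtain ⟨c, hσc, hcv, hc, hdich⟩ := exists_nonnorm_dichotomy_of_isRamifiedQuadraticDatum σ ϖ d t hD
  obtain ⟨j, rfl⟩ := h2
  have hϖ0 : ϖ ≠ 0 := fun h0 => by rw [h0, map_zero] at hϖ; exact WithZero.coe_ne_zero hϖ.symm
  have hϖ1 : Valued.v ϖ ≤ 1 := by rw [hϖ, ← WithZero.exp_zero, WithZero.exp_le_exp]; norm_num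
  have hσϖ0 : σ ϖ ≠ 0 := (map_ne_zero σ).2 hϖ0
  have hx0 : x ≠ 0 := fun h => by rw [h, map_zero] at hx; exact zero_ne_one hx
  have hc0 : c ≠ 0 := fun h => by rw [h, map_zero] at hcv; exact zero_ne_one hcv
  have hπ₀σ : σ (ϖ * σ ϖ) = ϖ * σ ϖ := by rw [map_mul, hσ, mul_comm]
  have hd₁σ : σ (((ϖ * σ ϖ) ^ j)⁻¹) = ((ϖ * σ ϖ) ^ j)⁻¹ := by rw [map_inv₀, map_pow, hπ₀σ]
  have hd₁0 : (((ϖ * σ ϖ) ^ j)⁻¹ : K) ≠ 0 := inv_ne_zero (pow_ne_zero _ (mul_ne_zero hϖ0 hσϖ0))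
  have hD₁ : ∀ k : Fin 3, σ ((![-(σ x * ((ϖ * σ ϖ) ^ j)⁻¹ * x), ((ϖ * σ ϖ) ^ j)⁻¹, 1] : Fin 3 → K) k) =
      (![-(σ x * ((ϖ * σ ϖ) ^ j)⁻¹ * x), ((ϖ * σ ϖ) ^ j)⁻¹, 1] : Fin 3 → K) k ∧ (![-(σ x * ((ϖ * σ ϖ) ^ j)⁻¹ * x), ((ϖ * σ ϖ) ^ j)⁻¹, 1] : Fin 3 → K) k ≠ 0 := by
    intro k
    fin_cases k
    · refine ⟨?_, ?_⟩
      · show σ (-(σ x * ((ϖ * σ ϖ) ^ j)⁻¹ * x)) = -(σ x * ((ϖ * σ ϖ) ^ j)⁻¹ * x)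
        rw [map_neg, map_mul, map_mul, hσ, hd₁σ]; ring
      · show -(σ x * ((ϖ * σ ϖ) ^ j)⁻¹ * x) ≠ 0
        exact neg_ne_zero.2 (mul_ne_zero (mul_ne_zero ((map_ne_zero σ).2 hx0) hd₁0) hx0)
    · exact ⟨hd₁σ, hd₁0⟩
    · exact ⟨map_one σ, one_ne_zero⟩
  rw [kappaCount_zero_eq_of_dichotomy hvσ hσc hc hdich ϖ i (Matrix.GeneralLinearGroup.mkOfDetNeZero _ (det_axis3_ne_zero hϖ0 x (2 * j)))
    (M := latt (!![1, 0, 0; x, ϖ ^ (2 * j), 0; 0, 0, 1] : Matrix (Fin 3) (Fin 3) K)) rfl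
    (isNormalisedLattice_latt_axis3 hϖ1 hx (2 * j)) hD₁ (isVertexLattice_latt_axis3 hvσ hϖ hx j)]
  -- the fixed-unit stabiliser: `u ∈ S_F ↔ u ∈ 𝒰^σ ∧ |u₁ − u₀| ≤ |ϖ^s|`
  have hSF := fun u => mem_fixedUnitStabilizer_latt_axis3_iff σ hϖ0 hx (2 * j) u
  by_cases hi : i = 2
  · subst hi
    by_cases hds : 2 * d ≤ 2 * j
    · -- ALIVE
      have hall : ∀ u ∈ fixedUnitStabilizer σ (latt (!![1, 0, 0; x, ϖ ^ (2 * j), 0; 0, 0, 1] : Matrix (Fin 3) (Fin 3) K)),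
          chiVec σ 2 (fun k => ((u k : Kˣ) : K)) = 1 := by
        intro u hu
        obtain ⟨huT, h10⟩ := (hSF u).1 hu
        obtain ⟨huv, huσ⟩ := (mem_fixedUnitTorus_iff σ u).1 huT
        have hle : Valued.v (((u 0 : Kˣ) : K) - (u 1 : Kˣ)) ≤ Valued.v ϖ ^ (2 * d) := by
          rw [Valuation.map_sub_swap]
          exact h10.trans (by rw [map_pow]; exact (UnitaryLatticeTree.v_pow_le_v_pow_iff hϖ _ _).2 hds)
        rw [chiVec_two]
        show normSign σ ((u 0 : Kˣ) : K) * normSign σ ((u 1 : Kˣ) : K) = 1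
        rw [normSign_eq_of_near hD (huσ 0) (huσ 1) (huv 0) (n := 2 * d) (by omega) hle, normSign_mul_self]
      rw [if_pos hall, if_pos (show (2 : Fin 3) = 2 ∧ 2 * d ≤ 2 * j from ⟨rfl, hds⟩), chiVec_two]
      show normSign σ (-(σ x * ((ϖ * σ ϖ) ^ j)⁻¹ * x)) * normSign σ (((ϖ * σ ϖ) ^ j)⁻¹) = normSign σ (-1)
      rw [normSign_neg_polarisation_entry hϖ0 hx0 j, normSign_normVarpi_pow_inv hϖ0 j, mul_one]
    · -- DEAD FOOT: the level-`j` non-norm `u₀` gives `(1, u₀, 1) ∈ S_F` with `χ_2 = ω(u₀) = −1`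
      obtain ⟨u₀, hσu₀, hu₀1, hu₀, hu₀n⟩ := exists_fixed_unit_not_norm_of_level_pow σ ϖ d t hD (n := j) (by omega)
      have hu₀0 : u₀ ≠ 0 := fun h => by rw [h, map_zero] at hu₀1; exact zero_ne_one hu₀1
      have hnall : ¬ ∀ u ∈ fixedUnitStabilizer σ (latt (!![1, 0, 0; x, ϖ ^ (2 * j), 0; 0, 0, 1] : Matrix (Fin 3) (Fin 3) K)),
          chiVec σ 2 (fun k => ((u k : Kˣ) : K)) = 1 := by
        intro hall
        have hmem : (![1, Units.mk0 u₀ hu₀0, 1] : Fin 3 → Kˣ) ∈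
            fixedUnitStabilizer σ (latt (!![1, 0, 0; x, ϖ ^ (2 * j), 0; 0, 0, 1] : Matrix (Fin 3) (Fin 3) K)) := by
          refine (hSF _).2 ⟨(mem_fixedUnitTorus_iff σ _).2 ⟨fun k => ?_, fun k => ?_⟩, ?_⟩
          · fin_cases k <;> simp [hu₀1]
          · fin_cases k <;> simp [hσu₀]
          · simpa using hu₀
        have h : normSign σ ((1 : Kˣ) : K) * normSign σ ((Units.mk0 u₀ hu₀0 : Kˣ) : K) = 1 := hall _ hmem
        rw [Units.val_one, Units.val_mk0, normSign_one, normSign_of_not_isNorm σ hu₀n] at h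
        norm_num at h
      rw [if_neg hnall, if_neg (fun h => hds h.2)]
  · -- DEAD OFF-FOOT: `(1, 1, c) ∈ S_F` with `χ_0 = χ_1 = ω(c) = −1`
    have hnall : ¬ ∀ u ∈ fixedUnitStabilizer σ (latt (!![1, 0, 0; x, ϖ ^ (2 * j), 0; 0, 0, 1] : Matrix (Fin 3) (Fin 3) K)),
        chiVec σ i (fun k => ((u k : Kˣ) : K)) = 1 := by
      intro hall
      have hmem : (![1, 1, Units.mk0 c hc0] : Fin 3 → Kˣ) ∈
          fixedUnitStabilizer σ (latt (!![1, 0, 0; x, ϖ ^ (2 * j), 0; 0, 0, 1] : Matrix (Fin 3) (Fin 3) K)) := by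
        refine (hSF _).2 ⟨(mem_fixedUnitTorus_iff σ _).2 ⟨fun k => ?_, fun k => ?_⟩, ?_⟩
        · fin_cases k <;> simp [hcv]
        · fin_cases k <;> simp [hσc]
        · simp
      have hωc := normSign_of_not_isNorm σ hc
      obtain rfl | rfl : i = 0 ∨ i = 1 := by
        fin_cases i
        · exact Or.inl rfl
        · exact Or.inr rfl
        · exact absurd rfl hi
      all_goals
        have h : normSign σ ((1 : Kˣ) : K) * normSign σ ((Units.mk0 c hc0 : Kˣ) : K) = 1 := hall _ hmem
        rw [Units.val_one, Units.val_mk0, normSign_one, hωc] at h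
        norm_num at h
    rw [if_neg hnall, if_neg (fun h => hi h.1)]

/-! ## §2  The root -/

/-- **THE ROOT `𝒪³`**: `S_F(𝒪³) = 𝒰^σ` contains `(c,1,1)` and `(1,c,1)`, so every `χ_i` takes the value `−1` on it and `kappaCount σ ϖ 0 i 𝒪³ = 0` (polarisation `diag(1,1,1)`).
[cite: Kottwitz1986BaseChangeUnits, §1 pp. 240–241] [cite: Rogawski1990, §4.10 p. 58] -/
theorem kappaCount_zero_stdLattice [CompleteSpace K] [Finite 𝓀[K]] {σ : K →+* K} {ϖ : K} {d t : ℕ} (hD : IsRamifiedQuadraticDatum σ ϖ d t)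
    (i : Fin 3) : kappaCount σ ϖ 0 i (stdLattice K 3) = 0 := by
  have hD' := hD
  obtain ⟨-, hvσ, hϖ, -, -, -, -⟩ := hD'
  haveI : IsAdicComplete 𝓂[K] 𝒪[K] := isAdicComplete_valuedInteger_of_completeSpace hϖ
  obtain ⟨c, hσc, hcv, hc, hdich⟩ := exists_nonnorm_dichotomy_of_isRamifiedQuadraticDatum σ ϖ d t hD
  have hϖ1 : Valued.v ϖ ≤ 1 := by rw [hϖ, ← WithZero.exp_zero, WithZero.exp_le_exp]; norm_num
  have hc0 : c ≠ 0 := fun h => by rw [h, map_zero] at hcv; exact zero_ne_one hcv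
  have hnorm : IsNormalisedLattice (stdLattice K 3) := fun k =>
    ⟨fun w hw => mem_stdLattice.1 hw k, Pi.single k 1, single_mem_stdLattice k, by rw [Pi.single_eq_same, map_one]⟩
  have h1 : ∀ k : Fin 3, Valued.v ((fun _ : Fin 3 => (1 : K)) k) = 1 := fun _ => map_one _
  have hV₁ : IsVertexLattice σ ϖ (Matrix.diagonal fun _ : Fin 3 => (1 : K)) 0 (stdLattice K 3) :=
    isSelfDualLattice_stdLattice (isIntMatrix_diagonal_of_v_le fun k => (h1 k).le) (isIntMatrix_diagonal_inv_of_v_eq_one h1) (v_det_diagonal_eq_one h1) hϖ1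
  have hD₁ : ∀ k : Fin 3, σ ((fun _ : Fin 3 => (1 : K)) k) = (fun _ : Fin 3 => (1 : K)) k ∧ (fun _ : Fin 3 => (1 : K)) k ≠ 0 :=
    fun _ => ⟨map_one σ, one_ne_zero⟩
  rw [kappaCount_zero_eq_of_dichotomy hvσ hσc hc hdich ϖ i (1 : GL (Fin 3) K) (M := stdLattice K 3) (by rw [Units.val_one, latt_one]) hnorm hD₁ hV₁,
    if_neg]
  -- every fixed unit diagonal stabilises `𝒪³`
  have hmem : ∀ U : Fin 3 → Kˣ, U ∈ fixedUnitTorus σ 3 → U ∈ fixedUnitStabilizer σ (stdLattice K 3) := fun U hU =>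
    (mem_fixedUnitStabilizer_iff σ _ U).2 ⟨mapGL_diagonal_stdLattice_eq ((mem_fixedUnitTorus_iff σ U).1 hU).1 (diagGLUnits U) (coe_diagGLUnits U),
      ((mem_fixedUnitTorus_iff σ U).1 hU).1, ((mem_fixedUnitTorus_iff σ U).1 hU).2⟩
  have hU₁ : (![Units.mk0 c hc0, 1, 1] : Fin 3 → Kˣ) ∈ fixedUnitTorus σ 3 :=
    (mem_fixedUnitTorus_iff σ _).2 ⟨fun k => by fin_cases k <;> simp [hcv], fun k => by fin_cases k <;> simp [hσc]⟩
  have hU₂ : (![1, Units.mk0 c hc0, 1] : Fin 3 → Kˣ) ∈ fixedUnitTorus σ 3 :=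
    (mem_fixedUnitTorus_iff σ _).2 ⟨fun k => by fin_cases k <;> simp [hcv], fun k => by fin_cases k <;> simp [hσc]⟩
  have hωc := normSign_of_not_isNorm σ hc
  intro hall
  obtain rfl | rfl | rfl : i = 0 ∨ i = 1 ∨ i = 2 := by
    fin_cases i
    · exact Or.inl rfl
    · exact Or.inr (Or.inl rfl)
    · exact Or.inr (Or.inr rfl)
  · have h : normSign σ ((Units.mk0 c hc0 : Kˣ) : K) * normSign σ ((1 : Kˣ) : K) = 1 := hall _ (hmem _ hU₂)
    rw [Units.val_one, Units.val_mk0, normSign_one, hωc] at h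
    norm_num at h
  all_goals
    have h : normSign σ ((Units.mk0 c hc0 : Kˣ) : K) * normSign σ ((1 : Kˣ) : K) = 1 := hall _ (hmem _ hU₁)
    rw [Units.val_one, Units.val_mk0, normSign_one, hωc] at h
    norm_num at h

end Summit.HodgeConjecture.HodgeConjecture.Cruxes.H413.F0P3cDyRamDiagonalKappaSplitCountValues

end
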